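import Literature.NumberTheory.EllipticCurves.OrdinaryPrimesProofs
import Literature.NumberTheory.EllipticCurves.GlobalMinimalModelProofs
import Literature.NumberTheory.EllipticCurves.ComplexMultiplicationTwistIsogenyProofs
import Literature.NumberTheory.EllipticCurves.QuadraticTwist
import Literature.NumberTheory.EllipticCurves.Rank1Residual.Predicates
import HarnessLib

/-!
# The quadratic twists `49a1^{(d)}`, `d ≡ 1 (mod 4)`, have GOOD reduction at `2` — the road-(C) input
# `AbsorbedTwistGoodAtTwo` of the crux idea `disegni-pair-two` (crux stmt-BirchSwinnertonDyer-20368) as a THEOREM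

Topic `Literature/NumberTheory/EllipticCurves` (theorems only; no definition, no named fact, no instance, no `sorry`). Cell
`bsd-print-cf2` (`run/shared/lean/pub/bsd-print-cf2/`), width seat `bsd-line-cf2-p1-w5` g19, `--supports` crux
stmt-BirchSwinnertonDyer-20368 (`PrintCf2.SplitBadTwoRankOneOfFacts`). The idea card `Cruxes/SplitBadTwoRankOneOfFacts/Ideas/
disegni-pair-two.md` (road (C) for the research statement 24034′ = 31080; planner `bsd-print-cf2-plan` g24, ENTRY-TICKET memo §2,
2026-08-30: «to be typed: the card's `AbsorbedTwistGoodAtTwo` (M-sized)») rests on the 2-ABSORPTION `λ_W = λ_{A′}·χ₂`: a member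
`W = cm7^{(d)}` (`d ≢ 1 (4)`, additive at `2`) is `A′ ⊗ χ_{d*}` with `A′ = 49a1^{(d′)}`, `d = d* d′`, `d′ ≡ 1 (mod 4)`, and the point is that
`A′` is GOOD (hence, `2` being split in `ℚ(√−7)`, ordinary) at `2` — First lemma (b) of the card:

  `AbsorbedTwistGoodAtTwo : ∀ d′, Squarefree d′ → d′ % 4 = 1 → ∀ A [IsElliptic] [IsGloballyMinimal] C, C • A = cm7.quadraticTwist d′ →
     Rank1Residual.Good A 2`.

THIS FILE proves it (as `absorbedTwistGoodAtTwo`, signature VERBATIM), from two more general statements: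
* ★ `WeierstrassCurve.hasGoodReductionAtPrime_of_smul_eq_map` — ANY Weierstrass equation `A/ℚ` that is `ℚ`-isomorphic to an INTEGER model
  `M` (`D • A = M ⊗ ℚ`) with `p ∤ Δ(M)` has good reduction at `p` (`A.HasGoodReductionAtPrime p`: the `ℤ_p`-minimal model of `A ⊗ ℚ_p` has
  unit discriminant). No minimality hypothesis on `A`: the proof is the tree's `hasGoodReductionAtPrime_of_not_dvd` (Silverman VII.1.1:
  an integral model with `v(Δ) = 0` is minimal, and minimal models have the same `v(Δ)`) run against the integral COMPETITOR `M ⊗ ℤ_p`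
  instead of the global minimal model.
* ★★ `cm7_quadraticTwist_hasGoodReductionAtPrime_two` — for `d ≡ 1 (mod 4)` and any `A`, `C` with `C • A = cm7.quadraticTwist d`:
  `A.HasGoodReductionAtPrime 2`. The integer model is `M_k = [1, −(3k+1), 0, −2d², −d³]`, `d = 4k + 1` (cell bsd-goldfeld's `W_k`,
  `X049TwistCMSigmaSqTwoProofs`: "`Δ(W_k) = −343·(4k+1)⁶` … a `ℤ₂`-integral model with good ORDINARY reduction at `2`"), reached from
  the tree's twist `cm7.quadraticTwist d = ⟨0, −3d/4, 0, −2d², −d³⟩` by the change of variables `(u, r, s, t) = (1, 0, ½, 0)`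
  (`cm7QuadraticTwistChange`, completing the square back: `y ↦ y + x/2`); `Δ(M_k) = −343·d⁶` is ODD.
HONEST FRAMING: elementary (Tate's algorithm is not needed: unit discriminant); nothing here is about BSD; no summit statement is proved.
presearch: «quadratic twist of 49a1 by d ≡ 1 mod 4 good at 2» → tree: `X049TwistCMSigmaSqTwoProofs` (model `W_k`, `cm7Twist_Δ`, docstring
claim only — `HasGoodReductionAtPrime 2` is carried there and in `BertrandCMHeightNonvanishingTwo` as a HYPOTHESIS `hgood`); corpus: Silverman AEC
VII.1 Remark 1.1 / X.5 (twists and conductors); none states this family-specific lemma (`lean search 'quadraticTwist.*HasGoodReduction'` = 0).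

## References
* [SilvermanAEC2009] J. H. Silverman, *The Arithmetic of Elliptic Curves*, 2nd ed. (2009), VII.1 Remark 1.1, VII.5 Prop. 5.1, III.1
  (change of variables), X.5 (quadratic twists).
* [RubinSilverberg2002] K. Rubin, A. Silverberg, *Ranks of elliptic curves*, Bull. AMS 39 (2002), §1 (the twist `E^{(d)}`).
-/

noncomputable section

open scoped Classical

namespace WeierstrassCurve

/-! ## §1. Good reduction from ANY integral model with unit discriminant -/

/-- ★ **Good reduction at `p` from an integral model with `p ∤ Δ`.** If a Weierstrass equation `A/ℚ` is `ℚ`-isomorphic to an integer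
model `M` (`D • A = M ⊗ ℚ` for a change of variables `D` over `ℚ`) and `p ∤ Δ(M)`, then `A` has good reduction at `p`
(`HasGoodReductionAtPrime`: the `ℤ_p`-minimal model of `A ⊗ ℚ_p` has unit discriminant). Proof: `M ⊗ ℤ_p` is an INTEGRAL model of
`A ⊗ ℚ_p` with `v_p(Δ) = 0`; the chosen minimal model `C • (A ⊗ ℚ_p)` has `v_p(Δ)` at most that of every integral model, in particular
of `M ⊗ ℤ_p = (D_p C⁻¹) • (C • A ⊗ ℚ_p)`, hence `v_p(Δ) = 0` (Silverman VII.1 Remark 1.1; the tree's `hasGoodReductionAtPrime_of_not_dvd`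
is the case `D = 1`, `M` = the global minimal model). [cite: SilvermanAEC2009, VII.1 Remark 1.1 and VII.5 Prop. 5.1] -/
theorem hasGoodReductionAtPrime_of_smul_eq_map (A : WeierstrassCurve ℚ) (p : ℕ) [Fact p.Prime] (M : WeierstrassCurve ℤ)
    (D : VariableChange ℚ) (hD : D • A = M.map (Int.castRingHom ℚ)) (hp : ¬ (p : ℤ) ∣ M.Δ) :
    A.HasGoodReductionAtPrime p := by
  unfold HasGoodReductionAtPrime
  -- `M ⊗ ℤ_p` is an integral model of `D_p • (A ⊗ ℚ_p)`
  set Mp : WeierstrassCurve ℤ_[p] := M.map (Int.castRingHom ℤ_[p]) with hMp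
  set Ap := A.baseChange ℚ_[p] with hAp
  set Dp : VariableChange ℚ_[p] := D.baseChange ℚ_[p] with hDp
  have hDA : Dp • Ap = Mp.baseChange ℚ_[p] := by
    rw [hDp, hAp, ← baseChange_smul_eq, hD, baseChange, baseChange, map_map, hMp, map_map]
    congr 1
  have hint : (Dp • Ap).IsIntegral ℤ_[p] := ⟨⟨Mp, hDA⟩⟩
  have hΔ : IsDedekindDomain.HeightOneSpectrum.valuation ℚ_[p]
      (IsDiscreteValuationRing.maximalIdeal ℤ_[p]) (Dp • Ap).Δ = 1 := by
    rw [hDA, baseChange, map_Δ, IsDedekindDomain.HeightOneSpectrum.valuation_eq_one_iff_notMem]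
    change Mp.Δ ∉ IsLocalRing.maximalIdeal ℤ_[p]
    rw [hMp, map_Δ, IsLocalRing.mem_maximalIdeal, PadicInt.mem_nonunits, eq_intCast,
      PadicInt.norm_int_lt_one_iff_dvd]
    exact hp
  -- the chosen minimal model `C • A_p` has valuation of `Δ` at least that of `D_p • A_p`, i.e. `1`
  have hmax := (inferInstance : (Ap.minimal ℤ_[p]).IsMinimal ℤ_[p]).val_Δ_maximal
  set C : VariableChange ℚ_[p] := (Ap.exists_isMinimal ℤ_[p]).choose with hC
  have hmin : Ap.minimal ℤ_[p] = C • Ap := rfl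
  have hj : ((Dp * C⁻¹) • Ap.minimal ℤ_[p]) = Dp • Ap := by rw [hmin, smul_smul, inv_mul_cancel_right]
  have hPj : ((Dp * C⁻¹) • Ap.minimal ℤ_[p]).IsIntegral ℤ_[p] := by rw [hj]; exact hint
  have hle : valuation_Δ_aux ℤ_[p] ((1 : VariableChange ℚ_[p]) • Ap.minimal ℤ_[p]) ≤
      valuation_Δ_aux ℤ_[p] ((Dp * C⁻¹) • Ap.minimal ℤ_[p]) := by
    rw [hj, ← Subtype.coe_le_coe, valuation_Δ_aux_eq_of_isIntegral ℤ_[p] (Dp • Ap), hΔ]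
    exact (valuation_Δ_aux ℤ_[p] _).2
  have hge := hmax.2 hPj hle
  simp only [] at hge
  rw [hj, ← Subtype.coe_le_coe, valuation_Δ_aux_eq_of_isIntegral ℤ_[p] (Dp • Ap), hΔ, one_smul,
    valuation_Δ_aux_eq_of_isIntegral] at hge
  obtain ⟨r, hr⟩ := Δ_integral_of_isIntegral ℤ_[p] (Ap.minimal ℤ_[p])
  refine ⟨le_antisymm ?_ hge⟩
  rw [← hr]
  exact IsDedekindDomain.HeightOneSpectrum.valuation_le_one _ _

end WeierstrassCurve

namespace Literature.NumberTheory.EllipticCurves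

open WeierstrassCurve

/-! ## §2. The twists `49a1^{(d)}`, `d ≡ 1 (mod 4)` -/

/-- The change of variables `(u, r, s, t) = (1, 0, ½, 0)` (complete the square back: `y ↦ y + x/2`), taking the tree's twist model
`cm7.quadraticTwist d = ⟨0, −3d/4, 0, −2d², −d³⟩` to the integral model `[1, −(3k+1), 0, −2d², −d³]` when `d = 4k + 1`.
[cite: SilvermanAEC2009, III.1 (admissible changes of variables)] -/
theorem cm7_quadraticTwist_smul_eq (k : ℤ) :
    (⟨1, 0, 1 / 2, 0⟩ : VariableChange ℚ) • cm7.quadraticTwist ((4 * k + 1 : ℤ) : ℚ) =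
      (⟨1, -(3 * k + 1), 0, -2 * (4 * k + 1) ^ 2, -(4 * k + 1) ^ 3⟩ : WeierstrassCurve ℤ).map (Int.castRingHom ℚ) := by
  ext
  · simp [variableChange_a₁, quadraticTwist]
  · simp [variableChange_a₂, quadraticTwist, WeierstrassCurve.b₂]
    ring
  · simp [variableChange_a₃, quadraticTwist]
  · simp [variableChange_a₄, quadraticTwist, WeierstrassCurve.b₄]
    ring
  · simp [variableChange_a₆, quadraticTwist, WeierstrassCurve.b₆]
    ring

/-- `Δ([1, −(3k+1), 0, −2d², −d³]) = −343·d⁶`, `d = 4k+1` (bsd-goldfeld's `cm7Twist_Δ`, over `ℤ`). [cite: SilvermanAEC2009, III.1] -/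
theorem cm7TwistInt_Δ (k : ℤ) :
    (⟨1, -(3 * k + 1), 0, -2 * (4 * k + 1) ^ 2, -(4 * k + 1) ^ 3⟩ : WeierstrassCurve ℤ).Δ = -343 * (4 * k + 1) ^ 6 := by
  simp only [WeierstrassCurve.Δ, WeierstrassCurve.b₂, WeierstrassCurve.b₄, WeierstrassCurve.b₆, WeierstrassCurve.b₈]
  ring

/-- `2 ∤ −343·d⁶` for `d = 4k + 1`. [folklore] -/
private theorem two_not_dvd_Δ (k : ℤ) : ¬ (2 : ℤ) ∣ -343 * (4 * k + 1) ^ 6 := by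
  intro h
  have h2 : Prime (2 : ℤ) := Int.prime_two
  rcases h2.dvd_or_dvd h with h1 | h1
  · omega
  · have := h2.dvd_of_dvd_pow h1
    omega

/-- ★★ **The twists `49a1^{(d)}` with `d ≡ 1 (mod 4)` have good reduction at `2`.** For `d : ℤ` with `d % 4 = 1` and any Weierstrass
equation `A/ℚ` with `C • A = cm7.quadraticTwist d` for some change of variables `C` over `ℚ`: `A.HasGoodReductionAtPrime 2` (the model
`[1, −(3k+1), 0, −2d², −d³]`, `d = 4k+1`, is integral with odd discriminant `−343·d⁶`). No minimality / ellipticity / square-freeness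
hypothesis is needed. [cite: SilvermanAEC2009, VII.1 Remark 1.1 and X.5] [cite: RubinSilverberg2002, §1] -/
theorem cm7_quadraticTwist_hasGoodReductionAtPrime_two [Fact (2 : ℕ).Prime] {d : ℤ} (hd : d % 4 = 1) (A : WeierstrassCurve ℚ)
    (C : VariableChange ℚ) (hC : C • A = cm7.quadraticTwist (d : ℚ)) : A.HasGoodReductionAtPrime 2 := by
  obtain ⟨k, rfl⟩ : ∃ k : ℤ, d = 4 * k + 1 := ⟨d / 4, by omega⟩
  refine hasGoodReductionAtPrime_of_smul_eq_map A 2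
    (⟨1, -(3 * k + 1), 0, -2 * (4 * k + 1) ^ 2, -(4 * k + 1) ^ 3⟩ : WeierstrassCurve ℤ)
    ((⟨1, 0, 1 / 2, 0⟩ : VariableChange ℚ) * C) ?_ ?_
  · rw [mul_smul, hC, cm7_quadraticTwist_smul_eq]
  · rw [cm7TwistInt_Δ]
    exact_mod_cast two_not_dvd_Δ k

/-- ★ **`AbsorbedTwistGoodAtTwo` — the card's First lemma (b), signature VERBATIM** (the binders `Squarefree d′`, `[A.IsElliptic]`,
`[A.IsGloballyMinimal]` are idle): for `d′` square-free with `d′ % 4 = 1` and every globally minimal elliptic `A` with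
`C • A = cm7.quadraticTwist d′`, `Rank1Residual.Good A 2` (`= A.HasGoodReductionAtPrime 2`). This puts the absorbed CM form `g″`
(newform of `A′ = 49a1^{(d′)}`) at level prime to `2`, the standing hypothesis «A/F_v potentially 𝔭-ordinary GOOD» of Disegni 2017 Thm. B
at the road-(C) point. [cite: SilvermanAEC2009, VII.1 Remark 1.1 and X.5] -/
theorem absorbedTwistGoodAtTwo [Fact (2 : ℕ).Prime] :
    ∀ d' : ℤ, Squarefree d' → d' % 4 = 1 → ∀ (A : WeierstrassCurve ℚ) [A.IsElliptic] [A.IsGloballyMinimal]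
      (C : VariableChange ℚ), C • A = cm7.quadraticTwist (d' : ℚ) → Rank1Residual.Good A 2 :=
  fun _ _ hd A _ _ C hC ↦ cm7_quadraticTwist_hasGoodReductionAtPrime_two hd A C hC

end Literature.NumberTheory.EllipticCurves

end
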